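import Summits.QuantumFields.GaugeBoot.UnitaryHaarSmallBallUpper
import Literature.MathematicalPhysics.QuantumFieldTheory.CircleHaarAngle
import Literature.MathematicalPhysics.QuantumLattice.GaugeGroups
import Literature.Analysis.Matrix.DetExp
import HarnessLib

/-!
# Gauge-boot: preparations for the `SU(N)` small-ball bounds — arcs of `U(1)`, the determinant of a
# unitary near `1`, and the multiplication map `U(1) × SU(N) → U(N)` (supplement 21, part 3b, file 1/2)

HONEST FRAMING (cell `pub-gaugeboot`, page 1 of every file): certified bounds on lattice
expectations at STATED coupling, gauge group, dimension and torus size; NOT a mass gap, NOT a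
continuum limit, NOT a string tension, NOT large `N`; NOT Yang–Mills-summit-bearing (barriers
`FixedCouplingUltralocality`, `PerturbativeInvisibility`).  Pure measure theory on compact groups;
it certifies no number.  Input of the explicit-constant `O(1/β)` bound of parts 3c–3e.

## Content

The multiplication map `m(z, V) = zV`, `U(1) × SU(N) → U(N)`, pushes the product of the Haar
probability measures to a LEFT-INVARIANT probability measure on `U(N)` (it is onto: every unitary
has an `N`-th root of its determinant), to which the tree's covering bound
(`haar_unitaryOpBall_ge`) and part 3a's packing bound (`haar_unitaryOpBall_le`) apply — no Haar
uniqueness on `U(N)` is needed.  Comparing the ball `{‖zV − 1‖ ≤ ρ}` with products: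

* `SUHaar.haar_circle_arc_ge`, `SUHaar.haar_circle_arc_le` — `ε/π ≤ λ{z ∈ U(1) : |z − 1| ≤ ε} ≤ ε/2`
  (`0 < ε ≤ 2`; angle parametrisation of the tree's `CircleHaarAngle`); `SUHaar.map_pow_haar_circle` —
  `z ↦ z^N` preserves `λ` (uniqueness of Haar measure on `U(1)`);
* `SUHaar.norm_det_sub_one_le` — for a unitary `M` with `‖M − 1‖_op < 2`:
  `|det M − 1| ≤ (Nπ/2)‖M − 1‖_op` (`M = e^{iH}`, `H = arg M`, `2(1 − cos‖H‖) = ‖M − 1‖²`,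
  `det e^{iH} = e^{i tr H}`, `|tr H| ≤ N‖H‖`);
* `SUHaar.toUnitary`, `toUnitary_surjective`, `SUHaar.prodHaar`, ★ `isMulLeftInvariant_prodHaar` — the map
  `m`, its surjectivity, and the left-invariant probability measure `m_*(Haar ⊗ Haar)` on `U(N)`.

File 2/2 (`SpecialUnitaryHaarSmallBall`) draws the two-sided bound with exponent `N² − 1`.  [folklore] (metric entropy of the classical groups, e.g. S. Szarek, Banach Center Publ.
43 (1998); everything here is proved from Mathlib and the tree.)
-/

open Complex NormedSpace selfAdjoint Unitary MeasureTheory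
open scoped Real Matrix.Norms.L2Operator Pointwise ENNReal NNReal
open Literature.Barriers.QuantumFields
open Literature.MathematicalPhysics.QuantumFieldTheory (haarProbability)
open Literature.MathematicalPhysics.QuantumFieldTheory.CircleHaar (angleMeasure measurePreserving_exp)

noncomputable section

namespace Summit.QuantumFields.GaugeBoot

namespace SUHaar

/-! ### Arcs of `U(1)` -/

/-- `(e^{it})^n = e^{int}` on the circle. [folklore] -/
theorem circleExp_pow (t : ℝ) (n : ℕ) : Circle.exp t ^ n = Circle.exp (n * t) := by
  rw [← Circle.exp_nsmul, nsmul_eq_mul]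

/-- Haar measure of a set of `U(1)` in angles: `λ(S) = (2π)⁻¹ |{θ ∈ (−π, π] : e^{iθ} ∈ S}|`. [folklore] -/
theorem haar_circle_eq (S : Set Circle) (hS : MeasurableSet S) :
    haarProbability Circle S =
      (ENNReal.ofReal (2 * π))⁻¹ * volume (Set.Ioc (-π) π ∩ Circle.exp ⁻¹' S) := by
  rw [← measurePreserving_exp.measure_preimage hS.nullMeasurableSet, angleMeasure, Measure.smul_apply,
    Measure.restrict_apply' measurableSet_Ioc, smul_eq_mul, Set.inter_comm]

/-- The arc `{z : |z − 1| ≤ ε}` is closed, hence measurable. [folklore] -/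
theorem measurableSet_arc (ε : ℝ) : MeasurableSet {z : Circle | ‖(z : ℂ) - 1‖ ≤ ε} :=
  (isClosed_le (by fun_prop) continuous_const).measurableSet

/-- **Lower arc bound**: `ε/π ≤ λ{z : |z − 1| ≤ ε}` for `0 ≤ ε ≤ π` (`|e^{iθ} − 1| ≤ |θ|`). [folklore] -/
theorem haar_circle_arc_ge {ε : ℝ} (hε : ε ≤ π) :
    ENNReal.ofReal (ε / π) ≤ haarProbability Circle {z : Circle | ‖(z : ℂ) - 1‖ ≤ ε} := by
  rw [haar_circle_eq _ (measurableSet_arc ε)]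
  have hsub : Set.Icc (-ε) ε ∩ Set.Ioc (-π) π ⊆ Set.Ioc (-π) π ∩ Circle.exp ⁻¹' {z : Circle | ‖(z : ℂ) - 1‖ ≤ ε} := by
    intro θ ⟨hθ, hθ'⟩
    refine ⟨hθ', ?_⟩
    simp only [Set.mem_preimage, Set.mem_setOf_eq, Circle.coe_exp]
    calc ‖Complex.exp (θ * Complex.I) - 1‖ = ‖Complex.exp (Complex.I * θ) - 1‖ := by rw [mul_comm]
      _ ≤ ‖θ‖ := Real.norm_exp_I_mul_ofReal_sub_one_le
      _ ≤ ε := by rw [Real.norm_eq_abs]; exact abs_le.2 hθ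
  have hvol : ENNReal.ofReal (2 * ε) ≤ volume (Set.Ioc (-π) π ∩ Circle.exp ⁻¹' {z : Circle | ‖(z : ℂ) - 1‖ ≤ ε}) := by
    refine le_trans ?_ (measure_mono hsub)
    rcases eq_or_lt_of_le hε with h | h
    · -- `ε = π`: the set is `(-π, π]` up to the null point `-π`
      have : Set.Ioc (-π) π ⊆ Set.Icc (-ε) ε ∩ Set.Ioc (-π) π := fun θ hθ => ⟨⟨by rw [h]; exact hθ.1.le, by rw [h]; exact hθ.2⟩, hθ⟩
      refine le_trans ?_ (measure_mono this)
      rw [Real.volume_Ioc, h]; ring_nf; exact le_rfl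
    · have : Set.Icc (-ε) ε ⊆ Set.Icc (-ε) ε ∩ Set.Ioc (-π) π := fun θ hθ => ⟨hθ, ⟨by linarith [hθ.1], by linarith [hθ.2]⟩⟩
      refine le_trans ?_ (measure_mono this)
      rw [Real.volume_Icc]; ring_nf; exact le_rfl
  calc ENNReal.ofReal (ε / π) = (ENNReal.ofReal (2 * π))⁻¹ * ENNReal.ofReal (2 * ε) := by
        rw [← ENNReal.ofReal_inv_of_pos (by positivity), ← ENNReal.ofReal_mul (by positivity)]
        congr 1; field_simp
    _ ≤ _ := by gcongr

/-- **Upper arc bound**: `λ{z : |z − 1| ≤ ε} ≤ ε/2` for `0 ≤ ε` (Jordan's inequality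
`|e^{iθ} − 1| = 2|sin(θ/2)| ≥ (2/π)|θ|` on `(−π, π]`). [folklore] -/
theorem haar_circle_arc_le (ε : ℝ) :
    haarProbability Circle {z : Circle | ‖(z : ℂ) - 1‖ ≤ ε} ≤ ENNReal.ofReal (ε / 2) := by
  rw [haar_circle_eq _ (measurableSet_arc ε)]
  have hsub : Set.Ioc (-π) π ∩ Circle.exp ⁻¹' {z : Circle | ‖(z : ℂ) - 1‖ ≤ ε} ⊆ Set.Icc (-(π * ε / 2)) (π * ε / 2) := by
    rintro θ ⟨⟨h1, h2⟩, hθ⟩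
    simp only [Set.mem_preimage, Set.mem_setOf_eq, Circle.coe_exp] at hθ
    rw [mul_comm, Complex.norm_exp_I_mul_ofReal_sub_one, Real.norm_eq_abs, abs_mul, abs_two] at hθ
    -- Jordan: `|sin(θ/2)| ≥ |θ|/π` for `|θ/2| ≤ π/2`
    have hj : |θ| / π ≤ |Real.sin (θ / 2)| := by
      rcases le_or_gt 0 θ with h | h
      · rw [abs_of_nonneg h, abs_of_nonneg (Real.sin_nonneg_of_nonneg_of_le_pi (by linarith) (by linarith))]
        have := Real.mul_le_sin (x := θ / 2) (by linarith) (by linarith)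
        calc θ / π = 2 / π * (θ / 2) := by ring
          _ ≤ Real.sin (θ / 2) := this
      · rw [abs_of_neg h]
        have hs : Real.sin (θ / 2) < 0 := Real.sin_neg_of_neg_of_neg_pi_lt (by linarith) (by linarith)
        rw [abs_of_neg hs, ← Real.sin_neg]
        have := Real.mul_le_sin (x := -(θ / 2)) (by linarith) (by linarith)
        calc -θ / π = 2 / π * (-(θ / 2)) := by ring
          _ ≤ Real.sin (-(θ / 2)) := this
    have : |θ| ≤ π * ε / 2 := by
      rw [div_le_iff₀ Real.pi_pos] at hj
      nlinarith [hj, abs_nonneg (Real.sin (θ / 2))]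
    exact abs_le.1 this
  calc (ENNReal.ofReal (2 * π))⁻¹ * volume (Set.Ioc (-π) π ∩ Circle.exp ⁻¹' {z : Circle | ‖(z : ℂ) - 1‖ ≤ ε})
      ≤ (ENNReal.ofReal (2 * π))⁻¹ * volume (Set.Icc (-(π * ε / 2)) (π * ε / 2)) := by gcongr
    _ = ENNReal.ofReal (ε / 2) := by
        rw [Real.volume_Icc, ← ENNReal.ofReal_inv_of_pos (by positivity), ← ENNReal.ofReal_mul (by positivity)]
        congr 1; field_simp; ring

/-- **`z ↦ z^N` preserves the Haar measure of `U(1)`** (`N ≥ 1`): the push-forward is a left-invariant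
probability measure (every `w` has an `N`-th root), hence Haar by uniqueness. [folklore] -/
theorem map_pow_haar_circle {N : ℕ} (hN : N ≠ 0) :
    (haarProbability Circle).map (fun z : Circle => z ^ N) = haarProbability Circle := by
  have hmeas : Measurable (fun z : Circle => z ^ N) := (continuous_pow N).measurable
  set ν := (haarProbability Circle).map (fun z : Circle => z ^ N) with hν
  haveI : IsProbabilityMeasure ν := Measure.isProbabilityMeasure_map hmeas.aemeasurable
  haveI : (haarProbability Circle).IsMulLeftInvariant :=
    inferInstanceAs ((Measure.haarMeasure (⊤ : TopologicalSpace.PositiveCompacts Circle)).IsMulLeftInvariant)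
  haveI : ν.IsMulLeftInvariant := by
    refine ⟨fun w => ?_⟩
    obtain ⟨w₀, hw₀⟩ : ∃ w₀ : Circle, w₀ ^ N = w := by
      refine ⟨Circle.exp (Complex.arg (w : ℂ) / N), ?_⟩
      rw [circleExp_pow, mul_div_cancel₀ _ (by exact_mod_cast hN), Circle.exp_arg]
    rw [hν, Measure.map_map (measurable_const_mul w) hmeas]
    have hcomp : (fun z : Circle => w * z) ∘ (fun z : Circle => z ^ N) = (fun z : Circle => z ^ N) ∘ (fun z => w₀ * z) := by
      funext z; simp [mul_pow, hw₀]
    rw [hcomp, ← Measure.map_map hmeas (measurable_const_mul w₀), map_mul_left_eq_self]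
  have h := Measure.haarMeasure_unique ν (⊤ : TopologicalSpace.PositiveCompacts Circle)
  rw [h]
  simp [haarProbability]

/-! ### The determinant of a unitary near the identity -/

section Det
variable {N : ℕ}

/-- `|tr H| ≤ N ‖H‖_op`. [folklore] -/
theorem norm_trace_le (H : Matrix (Fin N) (Fin N) ℂ) : ‖H.trace‖ ≤ N * ‖H‖ := by
  rw [Matrix.trace]
  calc ‖∑ i, H.diag i‖ ≤ ∑ i, ‖H.diag i‖ := norm_sum_le _ _
    _ ≤ ∑ _i : Fin N, ‖H‖ := Finset.sum_le_sum fun i _ => norm_entry_le_l2_opNorm H i i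
    _ = N * ‖H‖ := by simp

/-- `1 − cos x ≥ 2x²/π²` for `0 ≤ x ≤ π` (Jordan's inequality for `sin(x/2)`). [folklore] -/
theorem two_mul_sq_div_le_one_sub_cos {x : ℝ} (h0 : 0 ≤ x) (hπ : x ≤ π) :
    2 * x ^ 2 / π ^ 2 ≤ 1 - Real.cos x := by
  have hs : 1 - Real.cos x = 2 * Real.sin (x / 2) ^ 2 := by
    have h2 : Real.cos x = Real.cos (2 * (x / 2)) := by ring_nf
    rw [h2, Real.cos_two_mul]
    nlinarith [Real.sin_sq_add_cos_sq (x / 2)]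
  rw [hs]
  have hj := Real.mul_le_sin (x := x / 2) (by linarith) (by linarith)
  have hj0 : 0 ≤ 2 / π * (x / 2) := by positivity
  have := mul_le_mul hj hj hj0 (Real.sin_nonneg_of_nonneg_of_le_pi (by linarith) (by linarith))
  have hπ0 := Real.pi_pos
  have heq : 2 * x ^ 2 / π ^ 2 = 2 * (2 / π * (x / 2) * (2 / π * (x / 2))) := by field_simp
  rw [heq]
  nlinarith [this]

/-- **`|det M − 1| ≤ (Nπ/2) ‖M − 1‖_op`** for a unitary matrix `M` with `‖M − 1‖_op < 2`. [folklore] -/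
theorem norm_det_sub_one_le (M : Matrix.unitaryGroup (Fin N) ℂ)
    (hM : ‖(M : Matrix (Fin N) (Fin N) ℂ) - 1‖ < 2) :
    ‖(M : Matrix (Fin N) (Fin N) ℂ).det - 1‖ ≤ N * π / 2 * ‖(M : Matrix (Fin N) (Fin N) ℂ) - 1‖ := by
  letI : CStarAlgebra (Matrix (Fin N) (Fin N) ℂ) := {}
  set H : selfAdjoint (Matrix (Fin N) (Fin N) ℂ) := argSelfAdjoint M with hH
  have hexp : (expUnitary H : Matrix (Fin N) (Fin N) ℂ) = M := by
    rw [hH, expUnitary_argSelfAdjoint hM]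
  have hHπ : ‖(H : Matrix (Fin N) (Fin N) ℂ)‖ ≤ π := norm_argSelfAdjoint_le_pi M
  have hcos₀ := two_mul_one_sub_cos_norm_argSelfAdjoint hM
  rw [← hH] at hcos₀
  have hcos : 2 * (1 - Real.cos ‖(H : Matrix (Fin N) (Fin N) ℂ)‖) = ‖(M : Matrix (Fin N) (Fin N) ℂ) - 1‖ ^ 2 := by
    rw [← hcos₀]; rfl
  -- `‖H‖ ≤ (π/2) ‖M − 1‖`
  have hHle : ‖(H : Matrix (Fin N) (Fin N) ℂ)‖ ≤ π / 2 * ‖(M : Matrix (Fin N) (Fin N) ℂ) - 1‖ := by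
    have h1 := two_mul_sq_div_le_one_sub_cos (norm_nonneg (H : Matrix (Fin N) (Fin N) ℂ)) hHπ
    have h2 : (2 / π * ‖(H : Matrix (Fin N) (Fin N) ℂ)‖) ^ 2 ≤ ‖(M : Matrix (Fin N) (Fin N) ℂ) - 1‖ ^ 2 := by
      have hπ0 := Real.pi_pos
      calc (2 / π * ‖(H : Matrix (Fin N) (Fin N) ℂ)‖) ^ 2 = 2 * (2 * ‖(H : Matrix (Fin N) (Fin N) ℂ)‖ ^ 2 / π ^ 2) := by
            field_simp
        _ ≤ 2 * (1 - Real.cos ‖(H : Matrix (Fin N) (Fin N) ℂ)‖) := by linarith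
        _ = _ := hcos
    have h3 : 2 / π * ‖(H : Matrix (Fin N) (Fin N) ℂ)‖ ≤ ‖(M : Matrix (Fin N) (Fin N) ℂ) - 1‖ :=
      (pow_le_pow_iff_left₀ (by positivity) (norm_nonneg _) two_ne_zero).1 h2
    calc ‖(H : Matrix (Fin N) (Fin N) ℂ)‖ = π / 2 * (2 / π * ‖(H : Matrix (Fin N) (Fin N) ℂ)‖) := by field_simp
      _ ≤ π / 2 * ‖(M : Matrix (Fin N) (Fin N) ℂ) - 1‖ := by gcongr
  -- `det M = exp (i tr H)`
  have hdet : (M : Matrix (Fin N) (Fin N) ℂ).det = Complex.exp (Complex.I * (H : Matrix (Fin N) (Fin N) ℂ).trace) := by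
    rw [← hexp, expUnitary_coe, Literature.Analysis.Matrix.det_exp_eq_exp_trace, Matrix.trace_smul,
      smul_eq_mul, Complex.exp_eq_exp_ℂ]
  -- the trace of a Hermitian matrix is real
  have hHerm : Matrix.IsHermitian (H : Matrix (Fin N) (Fin N) ℂ) := Matrix.isHermitian_iff_isSelfAdjoint.2 H.2
  set t : ℝ := ∑ i, ((H : Matrix (Fin N) (Fin N) ℂ) i i).re with htdef
  have ht : (H : Matrix (Fin N) (Fin N) ℂ).trace = (t : ℂ) := by
    rw [htdef, Matrix.trace]
    push_cast
    refine Finset.sum_congr rfl fun i _ => ?_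
    have := hHerm.coe_re_apply_self i
    simpa using this.symm
  have htn : ‖(t : ℂ)‖ ≤ N * ‖(H : Matrix (Fin N) (Fin N) ℂ)‖ := by rw [← ht]; exact norm_trace_le _
  rw [hdet, ht]
  calc ‖Complex.exp (Complex.I * t) - 1‖ ≤ ‖t‖ := Real.norm_exp_I_mul_ofReal_sub_one_le
    _ = ‖(t : ℂ)‖ := (Complex.norm_real t).symm
    _ ≤ N * ‖(H : Matrix (Fin N) (Fin N) ℂ)‖ := htn
    _ ≤ N * (π / 2 * ‖(M : Matrix (Fin N) (Fin N) ℂ) - 1‖) := by gcongr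
    _ = N * π / 2 * ‖(M : Matrix (Fin N) (Fin N) ℂ) - 1‖ := by ring

end Det

/-! ### The multiplication map `U(1) × SU(N) → U(N)` -/

section Product
variable {N : ℕ}

/-- `z • A ∈ U(N)` for `z ∈ U(1)` and `A ∈ U(N)`. [folklore] -/
theorem smul_mem_unitaryGroup (z : Circle) {A : Matrix (Fin N) (Fin N) ℂ} (hA : A ∈ Matrix.unitaryGroup (Fin N) ℂ) :
    (z : ℂ) • A ∈ Matrix.unitaryGroup (Fin N) ℂ := by
  rw [Matrix.mem_unitaryGroup_iff] at hA ⊢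
  rw [star_smul, Matrix.smul_mul, Matrix.mul_smul, hA, smul_smul, Complex.star_def, Complex.mul_conj,
    Circle.normSq_coe, Complex.ofReal_one, one_smul]

/-- The multiplication map `m(z, V) = zV : U(1) × SU(N) → U(N)`. -/
def toUnitary (p : Circle × Matrix.specialUnitaryGroup (Fin N) ℂ) : Matrix.unitaryGroup (Fin N) ℂ :=
  ⟨(p.1 : ℂ) • (p.2 : Matrix (Fin N) (Fin N) ℂ),
    smul_mem_unitaryGroup p.1 (Matrix.mem_specialUnitaryGroup_iff.1 p.2.2).1⟩

/-- The matrix of `m(z, V)`. -/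
@[simp] theorem coe_toUnitary (p : Circle × Matrix.specialUnitaryGroup (Fin N) ℂ) :
    ((toUnitary p : Matrix.unitaryGroup (Fin N) ℂ) : Matrix (Fin N) (Fin N) ℂ) = (p.1 : ℂ) • (p.2 : Matrix (Fin N) (Fin N) ℂ) :=
  rfl

/-- `m` is continuous. [folklore] -/
theorem continuous_toUnitary : Continuous (toUnitary (N := N)) := by
  refine Continuous.subtype_mk ?_ _
  exact (continuous_subtype_val.comp continuous_fst).smul (continuous_subtype_val.comp continuous_snd)

/-- `m` is a homomorphism (scalars are central). [folklore] -/
theorem toUnitary_mul (p q : Circle × Matrix.specialUnitaryGroup (Fin N) ℂ) :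
    toUnitary (p * q) = toUnitary p * toUnitary q := by
  apply Subtype.ext
  simp only [coe_toUnitary, Prod.fst_mul, Prod.snd_mul, Circle.coe_mul, Submonoid.coe_mul,
    Matrix.smul_mul, Matrix.mul_smul, smul_smul, mul_comm (q.1 : ℂ)]

/-- The determinant of `m(z, V)` is `z^N`. [folklore] -/
theorem det_toUnitary (p : Circle × Matrix.specialUnitaryGroup (Fin N) ℂ) :
    ((toUnitary p : Matrix.unitaryGroup (Fin N) ℂ) : Matrix (Fin N) (Fin N) ℂ).det = (p.1 : ℂ) ^ N := by
  rw [coe_toUnitary, Matrix.det_smul, Fintype.card_fin, (Matrix.mem_specialUnitaryGroup_iff.1 p.2.2).2, mul_one]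

/-- **`m` is onto**: every unitary `W` is `zV` with `z^N = det W`, `V = z⁻¹W ∈ SU(N)` (`N ≥ 1`). [folklore] -/
theorem toUnitary_surjective (hN : N ≠ 0) : Function.Surjective (toUnitary (N := N)) := by
  intro W
  have hdet : ‖(W : Matrix (Fin N) (Fin N) ℂ).det‖ = 1 :=
    CStarRing.norm_of_mem_unitary (Matrix.det_of_mem_unitary W.2)
  set w : Circle := ⟨(W : Matrix (Fin N) (Fin N) ℂ).det, mem_sphere_zero_iff_norm.2 hdet⟩ with hw
  set z : Circle := Circle.exp (Complex.arg (w : ℂ) / N) with hz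
  have hzN : z ^ N = w := by
    rw [hz, circleExp_pow, mul_div_cancel₀ _ (by exact_mod_cast hN), Circle.exp_arg]
  have hzN' : (z : ℂ) ^ N = (W : Matrix (Fin N) (Fin N) ℂ).det := by
    have := congrArg (fun c : Circle => (c : ℂ)) hzN
    simpa [hw] using this
  have hmem : ((z⁻¹ : Circle) : ℂ) • (W : Matrix (Fin N) (Fin N) ℂ) ∈ Matrix.specialUnitaryGroup (Fin N) ℂ := by
    rw [Matrix.mem_specialUnitaryGroup_iff]
    refine ⟨smul_mem_unitaryGroup z⁻¹ W.2, ?_⟩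
    rw [Matrix.det_smul, Fintype.card_fin, ← hzN', Circle.coe_inv, inv_pow,
      inv_mul_cancel₀ (pow_ne_zero _ (Circle.coe_ne_zero z))]
  refine ⟨(z, ⟨_, hmem⟩), Subtype.ext ?_⟩
  simp only [coe_toUnitary, smul_smul, Circle.coe_inv, mul_inv_cancel₀ (Circle.coe_ne_zero z), one_smul]

/-- The Haar probability measure of a compact group is left invariant (an instance for the tree's
`haarProbability`). [folklore] -/
theorem isMulLeftInvariant_haarProbability (G : Type*) [Group G] [TopologicalSpace G] [IsTopologicalGroup G]
    [CompactSpace G] [MeasurableSpace G] [BorelSpace G] : (haarProbability G).IsMulLeftInvariant :=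
  inferInstanceAs ((Measure.haarMeasure (⊤ : TopologicalSpace.PositiveCompacts G)).IsMulLeftInvariant)

/-- The push-forward of `Haar_{U(1)} ⊗ Haar_{SU(N)}` under `m`: a left-invariant probability measure
on `U(N)` (`N ≥ 1`). -/
def prodHaar (N : ℕ) : Measure (Matrix.unitaryGroup (Fin N) ℂ) :=
  ((haarProbability Circle).prod (haarProbability (Matrix.specialUnitaryGroup (Fin N) ℂ))).map toUnitary

/-- `prodHaar` is a probability measure. [folklore] -/
theorem isProbabilityMeasure_prodHaar (N : ℕ) : IsProbabilityMeasure (prodHaar N) :=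
  Measure.isProbabilityMeasure_map continuous_toUnitary.measurable.aemeasurable

/-- `SU(N) ⊆ M_N(ℂ)` is second countable. [folklore] -/
theorem secondCountable_su (N : ℕ) : SecondCountableTopology (Matrix.specialUnitaryGroup (Fin N) ℂ) :=
  haveI : SecondCountableTopology (Matrix (Fin N) (Fin N) ℂ) :=
    inferInstanceAs (SecondCountableTopology (Fin N → Fin N → ℂ))
  Topology.IsEmbedding.subtypeVal.secondCountableTopology

/-- ★ **`prodHaar` is left invariant** (`N ≥ 1`; `m` is an onto homomorphism and the product Haar
measure is left invariant). [folklore] -/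
theorem isMulLeftInvariant_prodHaar (hN : N ≠ 0) : (prodHaar N).IsMulLeftInvariant := by
  haveI := isMulLeftInvariant_haarProbability Circle
  haveI := isMulLeftInvariant_haarProbability (Matrix.specialUnitaryGroup (Fin N) ℂ)
  haveI := secondCountable_su N
  refine ⟨fun W => ?_⟩
  obtain ⟨p₀, hp₀⟩ := toUnitary_surjective hN W
  rw [prodHaar, Measure.map_map (measurable_const_mul W) continuous_toUnitary.measurable]
  have hcomp : (fun U : Matrix.unitaryGroup (Fin N) ℂ => W * U) ∘ toUnitary = toUnitary ∘ fun p => p₀ * p := by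
    funext p; simp [Function.comp, toUnitary_mul, hp₀]
  rw [hcomp, ← Measure.map_map continuous_toUnitary.measurable (measurable_const_mul p₀), map_mul_left_eq_self]

end Product

end SUHaar

end Summit.QuantumFields.GaugeBoot

end
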